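import Literature.AlgebraicGeometry.Motives.AlgebraicClassesKunnethFullyAlgebraicFactor
import Literature.AlgebraicGeometry.Motives.ProjectiveSpaceFiniteFieldCohomology
import Literature.AlgebraicGeometry.Motives.TateConjectureAlgebraicCohomology
import HarnessLib

/-!
# Tate classes on `X × Z` for a factor `Z` with fully algebraic cohomology:
# `(H^{2c}(X × Z)(c))^Γ = ⊕_{p+q=c} (H^{2p}(X)(p))^Γ ⊗ H^{2q}(Z)`, hence
# `Tᶜ(X × Z) ⟺ Tᵖ(X)` for all `p + q = c` with `b_{2q}(Z) ≠ 0`; `T(X × 𝐏ʳ) ⟺ T(X)`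

Topic `Literature/AlgebraicGeometry/Motives`; THEOREMS ONLY (no definition, no instance, no named fact;
D-0026).

Let `E` be a Galois Weil cohomology theory (Tate 1994 §1; the tree's `GaloisWeilCohomology k K χ`: Galois
representations `ρ` on every `Hⁱ(X)`, Tate twists `Hⁱ(X)(j) = E.ρTwist X i j`, `Tᵖ(X) = E.TateConjectureFor X p`
«`K·Aᵖ(X) = (H^{2p}(X)(p))^{Γ_k}`»), `X`, `Z` smooth projective of dimensions `n`, `m`, and suppose ALL THE
COHOMOLOGY OF `Z` IS ALGEBRAIC: `K·A^q(Z) = H^{2q}(Z)` for every `q` and `b_{odd}(Z) = 0` (projective spaces,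
Grassmannians, odd-dimensional quadrics …).  Milne, *The Tate conjecture over finite fields* (2007) Th. 1.3,
proof: «`H^r(X)_a ⊗ H^{2d−r}(X)(d)_{1/a} ⊂ H^{2d}(X × X)(d)_1` (Künneth formula)»; Cor. 2.2:
«`T¹(X × Y, ℓ) ⟺ T¹(X, ℓ) + T¹(Y, ℓ)`.  PROOF. Compare the decomposition `NS(X × Y) ≃ NS(X) ⊕ NS(Y) ⊕
Hom(Alb(X), Pic⁰(Y))` with the similar decomposition of `H²(X × Y, ℚ_ℓ(1))` given by the Künneth formula.»
This file runs that comparison in every codimension for a factor `Z` of the above kind, where BOTH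
decompositions are as simple as possible:

* the Künneth isomorphism is Galois equivariant with the twist split over the factors
  (`ρTwist_externalCup`, `ρTwist_extTensor`, `kunnethComponent_ρTwist`), and `Γ_k` acts trivially on
  `H^{2q}(Z)(q) = K·A^q(Z)` (the tree's `ρTwist_eq_one_of_algebraicClasses_eq_top`, row g38-#10
  `TateConjectureAlgebraicCohomology`), so
  **`(H^{2c}(X × Z)(c))^Γ = Σ_{p+q=c} (H^{2p}(X)(p))^Γ × H^{2q}(Z)`** (`invariants_tensor_eq_iSup`,
  `mem_invariants_tensor_iff`: a class is invariant iff each Künneth component `z_{2p,2q}` lies in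
  `(H^{2p}(X)(p))^Γ ⊗ H^{2q}(Z)`; the odd components vanish);
* row g53-#1 (`AlgebraicClassesKunnethFullyAlgebraicFactor`): `K·Aᶜ(X × Z) = Σ_{p+q=c} K·Aᵖ(X) × H^{2q}(Z)`.

Comparing: **`Tᶜ(X × Z)` holds iff `Tᵖ(X)` holds for every `p + q = c` with `H^{2q}(Z) ≠ 0`**
(`tateConjectureFor_tensor_iff`; `⟸` `tateConjectureFor_tensor_of_forall` needs only the pieces, `⟹`
`tateConjectureFor_of_tensor` is the transfer `x = pr_{X*}((x × w) ∪ pr_Z^* b′)`, `tr_Z(w ∪ b′) = 1`, of an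
invariant class `x`, algebraic on `X × Z` by `Tᶜ(X × Z)` — Kleiman 1968 Prop. 1.2.4 ∕ Kahn 2020 §3.5.1).
Over a finite field, for `Z = 𝐏ʳ` (`b_{2q}(𝐏ʳ) = 1` for `q ≤ r`, `K·A^q(𝐏ʳ) = H^{2q}(𝐏ʳ) = K·ηq`, the
tree's `ProjectiveSpaceFiniteFieldCohomology`): **`Tᶜ(X × 𝐏ʳ) ⟺ Tᵖ(X)` for all `c − r ≤ p ≤ c`**
(`tateConjectureFor_tensor_projectiveSpace_iff`), so `T(X) ⟹ T(X × 𝐏ʳ)` in every codimension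
(`tateConjectureFor_tensor_projectiveSpace`), `T(𝐏ᵃ × 𝐏ʳ)` (`tateConjectureFor_projectiveSpace_prod`),
and `X × 𝐏ʳ` has fully algebraic even cohomology when `X` has (`algebraicClasses_tensor_projectiveSpace_eq_top`).

## What is here

* §1 (any field) equivariance: `ρTwist_externalCup` (`χ(g)^{s+t} g(x × w) = (χ(g)^s g x) × (χ(g)^t g w)`),
  `ρTwist_extTensor`, **`kunnethComponent_ρTwist`** (`(g z)_{a,b} = (g ⊗ g) z_{a,b}` with twists `s + t`),
  `kunnethComponent_ρTwist_natCast` (the twist `c = p + q` of `H^{2c}` split as `(p, q)`).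
* §2 (linear algebra, ns `Literature.LinearAlgebra.TensorContraction`) `rid_lTensor_rTensor` (contractions
  commute with `f ⊗ 1`), `mem_map₂_top_of_forall_rTensor_eq` (a tensor fixed by all `f_g ⊗ 1` lies in
  `V^{(f_g)} ⊗ W`), `rTensor_eq_self_of_mem_map₂` (converse).
* §3 **Tate classes of `X × Z`**: `externalCup_mem_invariants` (`x × w` is invariant for `x` invariant,
  `w ∈ H^{2q}(Z)`), `map₂_externalCup_invariants_le`, **`mem_invariants_tensor_iff`**,
  **`invariants_tensor_eq_iSup`**.
* §4 **the Tate conjecture**: `tateConjectureFor_of_subsingleton` (`Tᵖ(X)` is empty when `H^{2p}(X) = 0`),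
  **`tateConjectureFor_tensor_of_forall`** (`⟸`), **`tateConjectureFor_of_tensor`** (`⟹`, for each `q` with
  `H^{2q}(Z) ≠ 0`; only `K·A^q(Z) = H^{2q}(Z)` and `K·A^{m−q}(Z) = H^{2(m−q)}(Z)` are used),
  **`tateConjectureFor_tensor_iff`**, and the braiding `tateConjectureFor_tensor_comm` (`Tᶜ(X × Z) ⟹ Tᶜ(Z × X)`).
* §5 (`k` finite; `hE`, `hχ`, `hRH` for `𝐏ʳ` as in `ProjectiveSpaceFiniteFieldCohomology`)
  `nontrivial_projectiveSpace_iff` (`H^{2q}(𝐏ʳ) ≠ 0 ⟺ q ≤ r`), **`tateConjectureFor_tensor_projectiveSpace_iff`**,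
  `tateConjectureFor_tensor_projectiveSpace_of_forall`, **`tateConjectureFor_tensor_projectiveSpace`**,
  `tateConjectureFor_of_tensor_projectiveSpace` (`Tᶜ(X × 𝐏ʳ) ⟹ Tᵖ(X)`, `c − r ≤ p ≤ c` — sharper than the
  tree's domination descent `tateConjectureFor_of_tensor_left`, which gives `p = c` only),
  `tateConjectureFor_projectiveSpace_tensor` (`T(𝐏ʳ × X)`), **`tateConjectureFor_projectiveSpace_prod`**
  (`T(𝐏ᵃ × 𝐏ʳ)` in every codimension), `algebraicClasses_tensor_projectiveSpace_eq_top`.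

What is NOT here: the semisimplicity ∕ `hom = num` companions `S`, `E` of Tate's theorem for `X × Z`, pole
orders (rows g52-#8 ∕ #11 count them), the quadrics `ℰ × 𝐏ʳ`, `ℋ × 𝐏ʳ` (next row).  HC is not touched.

## References

* [Tate1994] J. Tate, *Conjectures on algebraic cycles in ℓ-adic cohomology*, in: Motives, PSPM 55.1 (1994),
  §1 (Conjecture `Tᵖ(X)`, Tate twists).
* [Milne2007TateFiniteFieldsAIM] J. S. Milne, *The Tate conjecture over finite fields (AIM talk)*,
  arXiv:0709.3040, §1 Th. 1.3 (proof, «Künneth formula»), §2 Cor. 2.2 («`T¹(X × Y) ⟺ T¹(X) + T¹(Y)`», proof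
  via the Künneth decomposition of `H²(X × Y, ℚ_ℓ(1))`).
* [TateWoodsHole1965] J. Tate, *Algebraic cycles and poles of zeta functions* (1965), §3 (12)–(13).
* [Kahn2020] B. Kahn, *Zeta and L-Functions of Varieties and Motives* (2020), §3.5.1 (projection formula),
  §6.4 Prop. 6.11 (6.4.1) (projective line formula).
* [Kleiman1968AlgebraicCycles] S. Kleiman, *Algebraic cycles and the Weil conjectures* (1968), §1.2 (B),
  Prop. 1.2.4, §1.3.
* [Hartshorne1977] R. Hartshorne, *Algebraic Geometry* (1977), App. C Ex. 5.2 (the Weil conjectures for `𝐏ʳ`).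
* [Roman2008] S. Roman, *Advanced Linear Algebra* (2008), Ch. 14 Th. 14.5–14.6.
* Tree: `AlgebraicClassesKunnethFullyAlgebraicFactor` (g53-#1), `FrobeniusSemisimpleOfSelfProductTate`
  (`ρTwist_externalCup_right`), `GaloisActionSemisimpleKunnethProducts` (`ρ_comp_extTensor`),
  `GaloisRealization` (`TateConjectureFor`, `algebraicClasses_le_invariants`),
  `TateConjectureAlgebraicCohomology` (`ρTwist_eq_one_of_algebraicClasses_eq_top`,
  `tateConjectureFor_of_algebraicClasses_eq_top`),
  `ProjectiveSpaceFiniteFieldCohomology` (`finrank_projectiveSpace_two_mul ∕ _of_odd`,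
  `algebraicClasses_projectiveSpace_eq_top`, `tateConjectureFor_projectiveSpace`),
  `TateConjectureDominatedVarieties` (`tateConjectureFor_of_pullback_top_ne_zero`).

## Provenance

Lane `lit-hodgefound` (summit `HodgeConjecture`, Track 2 foundations library, Layer B: motives ∕ Tate's
conjecture), seat `lit-hodgefound-p29` (literature-prover, generation 53, row g53-#2; FREE POINTER (β) of
generation 52: «`Tʳ(X × 𝐏ⁿ)` from `T^{r−i}(X)` needs a Galois-equivariant Künneth decomposition»).
-/

universe u v

open CategoryTheory AlgebraicGeometry MonoidalCategory CartesianMonoidalCategory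
open scoped TensorProduct

noncomputable section

/-! ### §2 Linear algebra: tensors fixed by `f ⊗ 1` -/

namespace Literature.LinearAlgebra.TensorContraction

variable {K : Type*} [Field K] {V W : Type*} [AddCommGroup V] [Module K V] [AddCommGroup W] [Module K W]

/-- Contractions against functionals of the second factor commute with endomorphisms of the first:
`ρ_φ((f ⊗ 1) t) = f(ρ_φ t)`. [cite: Roman2008, Ch. 14 Th. 14.5 (proof)] -/
theorem rid_lTensor_rTensor (φ : W →ₗ[K] K) (f : V →ₗ[K] V) (t : V ⊗[K] W) :
    TensorProduct.rid K V (LinearMap.lTensor V φ (LinearMap.rTensor W f t)) =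
      f (TensorProduct.rid K V (LinearMap.lTensor V φ t)) := by
  induction t using TensorProduct.induction_on with
  | zero => simp
  | tmul v w => rw [LinearMap.rTensor_tmul, rid_lTensor_tmul, rid_lTensor_tmul, map_smul]
  | add x y hx hy => rw [map_add, map_add, map_add, hx, hy, map_add, map_add, map_add]

/-- **A tensor fixed by every `f_g ⊗ 1` lies in `U ⊗ W` for any subspace `U` containing the common fixed
vectors of the `f_g`** (`W` finite-dimensional): its contractions are fixed by every `f_g`.
[cite: Roman2008, Ch. 14 Th. 14.6 (3)] -/
theorem mem_map₂_top_of_forall_rTensor_eq [Module.Finite K W] {ι : Type*} (f : ι → (V →ₗ[K] V))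
    (U : Submodule K V) (hU : ∀ v : V, (∀ g, f g v = v) → v ∈ U) {t : V ⊗[K] W}
    (ht : ∀ g, LinearMap.rTensor W (f g) t = t) :
    t ∈ Submodule.map₂ (TensorProduct.mk K V W) U ⊤ :=
  mem_map₂_top_of_forall_rid_lTensor_mem U fun φ ↦ hU _ fun g ↦ by
    rw [← rid_lTensor_rTensor φ (f g) t, ht g]

/-- Conversely `f ⊗ 1` fixes `U ⊗ S` when `f` fixes `U` pointwise. [cite: Roman2008, Ch. 14 Th. 14.5] -/
theorem rTensor_eq_self_of_mem_map₂ (f : V →ₗ[K] V) {U : Submodule K V} (hU : ∀ u ∈ U, f u = u)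
    (S : Submodule K W) {t : V ⊗[K] W} (ht : t ∈ Submodule.map₂ (TensorProduct.mk K V W) U S) :
    LinearMap.rTensor W f t = t := by
  rw [Submodule.map₂_eq_span_image2] at ht
  induction ht using Submodule.span_induction with
  | mem x hx =>
    obtain ⟨v, hv, w, -, rfl⟩ := hx
    dsimp only
    rw [TensorProduct.mk_apply, LinearMap.rTensor_tmul, hU v hv]
  | zero => rw [map_zero]
  | add x y _ _ hx hy => rw [map_add, hx, hy]
  | smul a x _ hx => rw [map_smul, hx]

end Literature.LinearAlgebra.TensorContraction

namespace Literature.AlgebraicGeometry.Motives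

namespace GaloisWeilCohomology

open Literature.LinearAlgebra.TensorContraction

variable {k : Type u} [Field k] {K : Type v} [Field K] [CharZero K]
  {χ : Field.absoluteGaloisGroup k →* Kˣ} (E : GaloisWeilCohomology k K χ)
variable {n m : ℕ} {X Z : SchemeOver k}

/-! ### §1 The Künneth decomposition is Galois equivariant, twists split over the factors -/

/-- **`χ(g)^{s+t}·g(pr_X^* x ∪ pr_Z^* w) = pr_X^*(χ(g)^s g x) ∪ pr_Z^*(χ(g)^t g w)`**: the external product
intertwines `Hⁱ(X)(s) ⊗ Hʲ(Z)(t)` with `H^{i+j}(X × Z)(s + t)` (Tate 1994 §1; the tree's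
`ρTwist_externalCup_right` is the case `s = 0`). [cite: Tate1994, §1] [cite: Milne2007TateFiniteFieldsAIM, Th. 1.3 (proof)] -/
theorem ρTwist_externalCup (hX : IsSmoothProjective n X) (hZ : IsSmoothProjective m Z) {i j e : ℕ}
    (h : i + j = e) (s t : ℤ) (g : Field.absoluteGaloisGroup k) (x : E.obj X i) (w : E.obj Z j) :
    E.ρTwist (X ⊗ Z) e (s + t) g (E.externalCup X Z h x w) =
      E.externalCup X Z h (E.ρTwist X i s g x) (E.ρTwist Z j t g w) := by
  rw [E.ρTwist_externalCup_right hX hZ h (s + t) g x w]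
  simp only [ρTwist_apply, map_smul, LinearMap.smul_apply, smul_smul]
  rw [zpow_add₀ (Units.ne_zero (χ g)), mul_comm]

/-- The same on the Künneth piece `Hⁱ(X) ⊗ Hʲ(Z)`: `χ(g)^{s+t} g ∘ ext = ext ∘ (χ(g)^s g ⊗ χ(g)^t g)`.
[cite: Tate1994, §1] [cite: Milne2007TateFiniteFieldsAIM, Th. 1.3 (proof)] -/
theorem ρTwist_extTensor (hX : IsSmoothProjective n X) (hZ : IsSmoothProjective m Z) {i j e : ℕ}
    (h : i + j = e) (s t : ℤ) (g : Field.absoluteGaloisGroup k) (u : E.obj X i ⊗[K] E.obj Z j) :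
    E.ρTwist (X ⊗ Z) e (s + t) g (E.extTensor h u) =
      E.extTensor h (TensorProduct.map (E.ρTwist X i s g) (E.ρTwist Z j t g) u) := by
  induction u using TensorProduct.induction_on with
  | zero => simp only [map_zero]
  | tmul x w => rw [E.extTensor_tmul, E.ρTwist_externalCup hX hZ h s t g x w, TensorProduct.map_tmul,
      E.extTensor_tmul]
  | add x y hx hy => rw [map_add, map_add, hx, hy, map_add, map_add]

/-- **Künneth components are Galois equivariant**: `(χ(g)^{s+t} g z)_{a,b} = (χ(g)^s g ⊗ χ(g)^t g)(z_{a,b})`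
(uniqueness of the Künneth decomposition). [cite: Tate1994, §1] [cite: Milne2007TateFiniteFieldsAIM, Th. 1.3 (proof)] -/
theorem kunnethComponent_ρTwist (hX : IsSmoothProjective n X) (hZ : IsSmoothProjective m Z)
    {a b d : ℕ} (h : a + b = d) (s t : ℤ) (g : Field.absoluteGaloisGroup k) (z : E.obj (X ⊗ Z) d) :
    E.kunnethComponent hX hZ a b h (E.ρTwist (X ⊗ Z) d (s + t) g z) =
      TensorProduct.map (E.ρTwist X a s g) (E.ρTwist Z b t g) (E.kunnethComponent hX hZ a b h z) := by
  conv_lhs => rw [← E.sum_extTensor_kunnethComponent hX hZ z]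
  rw [map_sum]
  simp_rw [E.ρTwist_extTensor hX hZ _ s t g]
  exact E.kunnethComponent_sum_extTensor hX hZ (fun ij ↦ TensorProduct.map (E.ρTwist X ij.1.1 s g)
    (E.ρTwist Z ij.1.2 t g) (E.kunnethComponent hX hZ ij.1.1 ij.1.2 (Finset.HasAntidiagonal.mem_antidiagonal.mp ij.2) z)) h

/-- The component of bidegree `(2p, 2q)` of `H^{2c}(X × Z)(c)`, `p + q = c`: the twist `c` splits as
`(p, q)`, `(χ(g)ᶜ g z)_{2p,2q} = (χ(g)ᵖ g ⊗ χ(g)^q g)(z_{2p,2q})`. [cite: Tate1994, §1] -/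
theorem kunnethComponent_ρTwist_natCast (hX : IsSmoothProjective n X) (hZ : IsSmoothProjective m Z)
    {p q c : ℕ} (hpq : p + q = c) (h : 2 * p + 2 * q = 2 * c) (g : Field.absoluteGaloisGroup k)
    (z : E.obj (X ⊗ Z) (2 * c)) :
    E.kunnethComponent hX hZ (2 * p) (2 * q) h (E.ρTwist (X ⊗ Z) (2 * c) c g z) =
      TensorProduct.map (E.ρTwist X (2 * p) p g) (E.ρTwist Z (2 * q) q g)
        (E.kunnethComponent hX hZ (2 * p) (2 * q) h z) := by
  have hc : ((c : ℕ) : ℤ) = (p : ℤ) + (q : ℤ) := by omega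
  rw [hc]
  exact E.kunnethComponent_ρTwist hX hZ h p q g z

/-! ### §3 Tate classes of `X × Z` -/

/-- **`x × w` is a Tate class of `X × Z` for `x ∈ (H^{2p}(X)(p))^Γ` and any `w ∈ H^{2q}(Z) = K·A^q(Z)`**
(`p + q = c`). [cite: Tate1994, §1] [cite: Milne2007TateFiniteFieldsAIM, Cor. 2.2 (proof)] -/
theorem externalCup_mem_invariants (hX : IsSmoothProjective n X) (hZ : IsSmoothProjective m Z)
    {p q c : ℕ} (hpq : p + q = c) (hZq : E.algebraicClasses Z q = ⊤) (h : 2 * p + 2 * q = 2 * c)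
    {x : E.obj X (2 * p)} (hx : x ∈ (E.ρTwist X (2 * p) p).invariants) (w : E.obj Z (2 * q)) :
    E.externalCup X Z h x w ∈ (E.ρTwist (X ⊗ Z) (2 * c) c).invariants := fun g ↦ by
  have hc : ((c : ℕ) : ℤ) = (p : ℤ) + (q : ℤ) := by omega
  rw [hc, E.ρTwist_externalCup hX hZ h p q g x w, hx g,
    LinearMap.congr_fun (E.ρTwist_eq_one_of_algebraicClasses_eq_top hZ hZq g) w, Module.End.one_apply]

/-- `(H^{2p}(X)(p))^Γ × H^{2q}(Z) ⊆ (H^{2c}(X × Z)(c))^Γ` (`p + q = c`, `K·A^q(Z) = H^{2q}(Z)`).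
[cite: Tate1994, §1] [cite: Milne2007TateFiniteFieldsAIM, Cor. 2.2 (proof)] -/
theorem map₂_externalCup_invariants_le (hX : IsSmoothProjective n X) (hZ : IsSmoothProjective m Z)
    {p q c : ℕ} (hpq : p + q = c) (hZq : E.algebraicClasses Z q = ⊤) (h : 2 * p + 2 * q = 2 * c) :
    Submodule.map₂ (E.externalCup X Z h) (E.ρTwist X (2 * p) p).invariants ⊤ ≤
      (E.ρTwist (X ⊗ Z) (2 * c) c).invariants :=
  Submodule.map₂_le.mpr fun _ hx w _ ↦ E.externalCup_mem_invariants hX hZ hpq hZq h hx w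

/-- **A class `z ∈ H^{2c}(X × Z)(c)` is Galois invariant iff every Künneth component `z_{2p,2q}` lies in
`(H^{2p}(X)(p))^Γ ⊗ H^{2q}(Z)`**, for `Z` with `K·A^q(Z) = H^{2q}(Z)` for all `q` and `b_{odd}(Z) = 0` («the
similar decomposition of `H²(X × Y, ℚ_ℓ(1))` given by the Künneth formula», in all degrees).
[cite: Milne2007TateFiniteFieldsAIM, Cor. 2.2 (proof) and Th. 1.3 (proof)] [cite: Tate1994, §1]
[cite: Roman2008, Ch. 14 Th. 14.6 (3)] -/
theorem mem_invariants_tensor_iff (hX : IsSmoothProjective n X) (hZ : IsSmoothProjective m Z)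
    (hZalg : ∀ q, E.algebraicClasses Z q = ⊤) (hZodd : ∀ j, Odd j → Module.finrank K (E.obj Z j) = 0)
    {c : ℕ} (z : E.obj (X ⊗ Z) (2 * c)) :
    z ∈ (E.ρTwist (X ⊗ Z) (2 * c) c).invariants ↔
      ∀ (p q : ℕ) (h : 2 * p + 2 * q = 2 * c), E.kunnethComponent hX hZ (2 * p) (2 * q) h z ∈
        Submodule.map₂ (TensorProduct.mk K (E.obj X (2 * p)) (E.obj Z (2 * q)))
          (E.ρTwist X (2 * p) p).invariants ⊤ := by
  constructor
  · intro hz p q h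
    haveI := E.finite_obj hZ (2 * q)
    refine mem_map₂_top_of_forall_rTensor_eq (fun g ↦ E.ρTwist X (2 * p) p g) _
      (fun v hv ↦ (Representation.mem_invariants _ v).mpr hv) fun g ↦ ?_
    have hcomp := E.kunnethComponent_ρTwist_natCast hX hZ (by omega) h g z
    rw [hz g, E.ρTwist_eq_one_of_algebraicClasses_eq_top hZ (hZalg q) g, Module.End.one_eq_id] at hcomp
    exact hcomp.symm
  · intro hz g
    conv_lhs => rw [← E.sum_extTensor_kunnethComponent hX hZ z]
    conv_rhs => rw [← E.sum_extTensor_kunnethComponent hX hZ z]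
    rw [map_sum]
    refine Finset.sum_congr rfl fun ij _ ↦ ?_
    obtain ⟨⟨a, b⟩, hab⟩ := ij
    have hab' : a + b = 2 * c := Finset.HasAntidiagonal.mem_antidiagonal.mp hab
    rcases Nat.even_or_odd b with hb | hb
    · obtain ⟨q, rfl⟩ : ∃ q, b = 2 * q := ⟨b / 2, by have := Nat.even_iff.mp hb; omega⟩
      obtain ⟨p, rfl⟩ : ∃ p, a = 2 * p := ⟨c - q, by omega⟩
      have hc : ((c : ℕ) : ℤ) = (p : ℤ) + (q : ℤ) := by omega
      dsimp only
      rw [hc, E.ρTwist_extTensor hX hZ _ p q g, E.ρTwist_eq_one_of_algebraicClasses_eq_top hZ (hZalg q) g,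
        Module.End.one_eq_id]
      exact congrArg _ (rTensor_eq_self_of_mem_map₂ _
        (fun u hu ↦ (Representation.mem_invariants _ u).mp hu g) ⊤ (hz p q _))
    · dsimp only
      rw [E.kunnethComponent_eq_zero_of_odd_right hX hZ hZodd hb, map_zero, map_zero]

/-- **`(H^{2c}(X × Z)(c))^Γ = Σ_{p+q=c} (H^{2p}(X)(p))^Γ × H^{2q}(Z)`** for `Z` with fully algebraic
cohomology: the Tate classes of `X × Z` are the sums of external products of Tate classes of `X` with
classes of `Z`. [cite: Milne2007TateFiniteFieldsAIM, Cor. 2.2 (proof) and Th. 1.3 (proof)] [cite: Tate1994, §1] -/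
theorem invariants_tensor_eq_iSup (hX : IsSmoothProjective n X) (hZ : IsSmoothProjective m Z)
    (hZalg : ∀ q, E.algebraicClasses Z q = ⊤) (hZodd : ∀ j, Odd j → Module.finrank K (E.obj Z j) = 0)
    (c : ℕ) :
    (E.ρTwist (X ⊗ Z) (2 * c) c).invariants =
      ⨆ (p : ℕ) (q : ℕ) (h : 2 * p + 2 * q = 2 * c),
        Submodule.map₂ (E.externalCup X Z h) (E.ρTwist X (2 * p) p).invariants ⊤ := by
  refine le_antisymm (fun z hz ↦ ?_) ?_
  · rw [← E.sum_extTensor_kunnethComponent hX hZ z]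
    refine Submodule.sum_mem _ fun ij _ ↦ ?_
    obtain ⟨⟨a, b⟩, hab⟩ := ij
    have hab' : a + b = 2 * c := Finset.HasAntidiagonal.mem_antidiagonal.mp hab
    rcases Nat.even_or_odd b with hb | hb
    · obtain ⟨q, rfl⟩ : ∃ q, b = 2 * q := ⟨b / 2, by have := Nat.even_iff.mp hb; omega⟩
      obtain ⟨p, rfl⟩ : ∃ p, a = 2 * p := ⟨c - q, by omega⟩
      have key := E.extTensor_mem_map₂_externalCup (Finset.HasAntidiagonal.mem_antidiagonal.mp hab) _ _
        ((E.mem_invariants_tensor_iff hX hZ hZalg hZodd z).mp hz p q (Finset.HasAntidiagonal.mem_antidiagonal.mp hab))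
      exact Submodule.mem_iSup_of_mem p (Submodule.mem_iSup_of_mem q
        (Submodule.mem_iSup_of_mem (Finset.HasAntidiagonal.mem_antidiagonal.mp hab) key))
    · rw [E.kunnethComponent_eq_zero_of_odd_right hX hZ hZodd hb, map_zero]
      exact Submodule.zero_mem _
  · exact iSup_le fun p ↦ iSup_le fun q ↦ iSup_le fun h ↦
      E.map₂_externalCup_invariants_le hX hZ (by omega) (hZalg q) h

/-! ### §4 The Tate conjecture for `X × Z` -/

/-- `Tᵖ(X)` holds trivially when `H^{2p}(X) = 0` (in particular for `p > dim X`). [cite: Tate1994, §1] -/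
theorem tateConjectureFor_of_subsingleton {p : ℕ} [Subsingleton (E.obj X (2 * p))] :
    E.TateConjectureFor X p :=
  Subsingleton.elim _ _

/-- **`Tᵖ(X)` for all `p + q = c` with `H^{2q}(Z) ≠ 0` ⟹ `Tᶜ(X × Z)`** for `Z` with `K·A^q(Z) = H^{2q}(Z)`
for all `q` and `b_{odd}(Z) = 0`: every Tate class of `X × Z` is a sum of `x × w` with `x` a Tate class of
`X` (`invariants_tensor_eq_iSup`), algebraic by `Tᵖ(X)`, and `K·Aᵖ(X) × H^{2q}(Z) ⊆ K·Aᶜ(X × Z)`.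
[cite: Milne2007TateFiniteFieldsAIM, Cor. 2.2] [cite: Tate1994, §1 (Conjecture Tᵖ)] [cite: TateWoodsHole1965, §3 (12)–(13)] -/
theorem tateConjectureFor_tensor_of_forall (hX : IsSmoothProjective n X) (hZ : IsSmoothProjective m Z)
    (hZalg : ∀ q, E.algebraicClasses Z q = ⊤) (hZodd : ∀ j, Odd j → Module.finrank K (E.obj Z j) = 0)
    {c : ℕ} (hT : ∀ p q : ℕ, p + q = c → Nontrivial (E.obj Z (2 * q)) → E.TateConjectureFor X p) :
    E.TateConjectureFor (X ⊗ Z) c := by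
  refine le_antisymm (E.algebraicClasses_le_invariants (IsSmoothProjective.tensor_holds hX hZ) c) ?_
  rw [E.invariants_tensor_eq_iSup hX hZ hZalg hZodd c]
  refine iSup_le fun p ↦ iSup_le fun q ↦ iSup_le fun h ↦ ?_
  rcases subsingleton_or_nontrivial (E.obj Z (2 * q)) with hq | hq
  · refine Submodule.map₂_le.mpr fun x _ w _ ↦ ?_
    rw [Subsingleton.elim w 0, map_zero]
    exact Submodule.zero_mem _
  · rw [← hT p q (by omega) hq]
    exact E.map₂_externalCup_algebraicClasses_top_le hX hZ (by omega) (hZalg q) h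

/-- **`Tᶜ(X × Z) ⟹ Tᵖ(X)` for every `p + q = c` with `H^{2q}(Z) ≠ 0`**, provided `K·A^q(Z) = H^{2q}(Z)` and
`K·A^{q′}(Z) = H^{2q′}(Z)`, `q + q′ = m`: for `x ∈ (H^{2p}(X)(p))^Γ` pick `0 ≠ w ∈ H^{2q}(Z)` and `b′ ∈ H^{2q′}(Z)`
with `tr_Z(w ∪ b′) = 1` (Poincaré duality); then `x × w` is a Tate class of `X × Z`, algebraic by `Tᶜ(X × Z)`,
and `x = pr_{X*}((x × w) ∪ pr_Z^* b′)` is algebraic (the transfer preserves algebraic classes — Kleiman 1968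
Prop. 1.2.4 ∕ §1.3, Kahn §3.5.1).  For `q = 0` this is the tree's domination descent
`tateConjectureFor_of_tensor_left`. [cite: Kleiman1968AlgebraicCycles, §1.2 Prop. 1.2.4 and §1.3]
[cite: Kahn2020, §3.5.1] [cite: Tate1994, §1 (Conjecture Tᵖ)] -/
theorem tateConjectureFor_of_tensor (hX : IsSmoothProjective n X) (hZ : IsSmoothProjective m Z)
    {p q c q' : ℕ} (hpq : p + q = c) (hqq' : q + q' = m) (hZq : E.algebraicClasses Z q = ⊤)
    (hZq' : E.algebraicClasses Z q' = ⊤) [Nontrivial (E.obj Z (2 * q))]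
    (hT : E.TateConjectureFor (X ⊗ Z) c) : E.TateConjectureFor X p := by
  by_cases hp : p ≤ n
  swap
  · haveI := E.subsingleton_obj hX (i := 2 * p) (by omega)
    exact E.tateConjectureFor_of_subsingleton
  refine le_antisymm (E.algebraicClasses_le_invariants hX p) fun x hx ↦ ?_
  -- a class `w ≠ 0` of `H^{2q}(Z)` and a Poincaré-dual `b′` with `tr_Z(w ∪ b′) = 1`
  obtain ⟨w, hw⟩ := exists_ne (0 : E.obj Z (2 * q))
  have hh : 2 * q + 2 * q' = 2 * m := by omega
  haveI := E.isPerfPair_cupPairing hZ (2 * q) (2 * q') hh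
  have hBw : E.cupPairing Z m (2 * q) (2 * q') hh w ≠ 0 := fun h0 ↦ hw
    ((LinearMap.IsPerfPair.bijective_left (E.cupPairing Z m (2 * q) (2 * q') hh)).1 (by rw [h0, map_zero]))
  obtain ⟨b₀, hb₀⟩ := DFunLike.ne_iff.mp hBw
  rw [LinearMap.zero_apply] at hb₀
  set b' : E.obj Z (2 * q') := (E.cupPairing Z m (2 * q) (2 * q') hh w b₀)⁻¹ • b₀ with hb'
  have htr : E.trace Z m (E.cup hh w b') = 1 := by
    rw [hb', map_smul, map_smul, ← E.cupPairing_apply, smul_eq_mul, inv_mul_cancel₀ hb₀]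
  -- `x × w` is a Tate class, hence algebraic on `X × Z`
  have h2 : 2 * p + 2 * q = 2 * c := by omega
  have hmem : E.externalCup X Z h2 x w ∈ E.algebraicClasses (X ⊗ Z) c := by
    rw [hT]
    exact E.externalCup_mem_invariants hX hZ hpq hZq h2 hx w
  -- transfer back to `X`
  have key := E.pushforward_fst_cup_snd_mem_algebraicClasses hX hZ (r := c + q') (p := p)
    (d' := 2 * n - 2 * p) rfl (by omega) (by omega) (by omega) hmem (b' := b')
    (by rw [hZq']; exact Submodule.mem_top)
  rwa [E.pushforward_fst_externalCup_cup_snd hX hZ h2 hh (by omega) (by omega) (by omega) x w b', htr,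
    one_smul] at key

/-- **`Tᶜ(X × Z) ⟺ (Tᵖ(X)` for all `p + q = c` with `H^{2q}(Z) ≠ 0)`** for `Z` with `K·A^q(Z) = H^{2q}(Z)` for
all `q` and `b_{odd}(Z) = 0` (Milne's Cor. 2.2 «`T¹(X × Y) ⟺ T¹(X) + T¹(Y)`» in every codimension, for a factor
whose own Tate conjecture holds tautologically). [cite: Milne2007TateFiniteFieldsAIM, Cor. 2.2]
[cite: Tate1994, §1 (Conjecture Tᵖ)] [cite: TateWoodsHole1965, §3 (12)–(13)] -/
theorem tateConjectureFor_tensor_iff (hX : IsSmoothProjective n X) (hZ : IsSmoothProjective m Z)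
    (hZalg : ∀ q, E.algebraicClasses Z q = ⊤) (hZodd : ∀ j, Odd j → Module.finrank K (E.obj Z j) = 0)
    (c : ℕ) :
    E.TateConjectureFor (X ⊗ Z) c ↔
      ∀ p q : ℕ, p + q = c → Nontrivial (E.obj Z (2 * q)) → E.TateConjectureFor X p := by
  refine ⟨fun hT p q hpq hq ↦ ?_, E.tateConjectureFor_tensor_of_forall hX hZ hZalg hZodd⟩
  have hqm : q ≤ m := by
    by_contra hqm
    haveI := E.subsingleton_obj hZ (i := 2 * q) (by omega)
    exact false_of_nontrivial_of_subsingleton (E.obj Z (2 * q))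
  exact E.tateConjectureFor_of_tensor hX hZ hpq (q' := m - q) (by omega) (hZalg q) (hZalg _) hT

/-- **`Tᶜ(X × Z) ⟹ Tᶜ(Z × X)`** along the braiding `Z × X ≅ X × Z` (an isomorphism dominates:
`σ* ≠ 0` on the top cohomology). [cite: Tate1994, §1] [cite: Kleiman1968AlgebraicCycles, §1.2 Prop. 1.2.4] -/
theorem tateConjectureFor_tensor_comm (hX : IsSmoothProjective n X) (hZ : IsSmoothProjective m Z) {c : ℕ}
    (hT : E.TateConjectureFor (X ⊗ Z) c) : E.TateConjectureFor (Z ⊗ X) c := by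
  have hXZ : IsSmoothProjective (n + m) (X ⊗ Z) := IsSmoothProjective.tensor_holds hX hZ
  have hZX : IsSmoothProjective (n + m) (Z ⊗ X) := by
    rw [Nat.add_comm]; exact IsSmoothProjective.tensor_holds hZ hX
  refine E.tateConjectureFor_of_pullback_top_ne_zero hXZ hZX (β_ X Z).hom (fun h0 ↦ ?_) hT
  -- `σ*` is surjective (`σ* ∘ σ⁻¹* = id`) onto `H^{2(n+m)}(X × Z) ≠ 0`
  have hsurj : Function.Surjective (E.pullback (β_ X Z).hom (2 * (n + m))) :=
    Function.RightInverse.surjective (g := E.pullback (β_ X Z).inv (2 * (n + m))) fun y ↦ by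
      rw [← LinearMap.comp_apply, ← E.pullback_comp, Iso.hom_inv_id, E.pullback_id, LinearMap.id_apply]
  obtain ⟨y, hy⟩ := (E.bijective_trace hXZ).2 1
  obtain ⟨y', rfl⟩ := hsurj y
  rw [h0, LinearMap.zero_apply, map_zero] at hy
  exact zero_ne_one hy

/-! ### §5 `Z = 𝐏ʳ` over a finite field -/

section ProjectiveSpace

variable [Finite k] {r : ℕ}

/-- `H^{2q}(𝐏ʳ) ≠ 0` iff `q ≤ r` (`b_{2q}(𝐏ʳ) = 1` for `q ≤ r`, `= 0` beyond; the tree's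
`finrank_projectiveSpace_two_mul`), granted the Riemann hypothesis for `𝐏ʳ` in `E`.
[cite: Hartshorne1977, App. C Ex. 5.2] -/
theorem nontrivial_projectiveSpace_iff (hE : E.HasLefschetzTraceFormula)
    (hχ : ((χ (arithFrob k) : Kˣ) : K) = Nat.card k)
    (hRH : E.WeilRiemannHypothesisFor (projectiveSpace r k) r) {q : ℕ} :
    Nontrivial (E.obj (projectiveSpace r k) (2 * q)) ↔ q ≤ r := by
  have hP := isSmoothProjective_projectiveSpace_holds k r
  constructor
  · intro hq
    by_contra hqr
    haveI := E.subsingleton_obj hP (i := 2 * q) (by omega)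
    exact false_of_nontrivial_of_subsingleton (E.obj (projectiveSpace r k) (2 * q))
  · intro hq
    haveI := E.finite_obj hP (2 * q)
    exact Module.nontrivial_of_finrank_eq_succ (E.finrank_projectiveSpace_two_mul hE hχ hRH hq)

/-- **`Tᶜ(X × 𝐏ʳ) ⟺ Tᵖ(X)` for all `p + q = c`, `q ≤ r`** (i.e. `c − r ≤ p ≤ c`), over a finite field,
granted the Riemann hypothesis for `𝐏ʳ` in `E`. [cite: Milne2007TateFiniteFieldsAIM, Cor. 2.2]
[cite: Tate1994, §1 (Conjecture Tᵖ)] [cite: Kahn2020, §6.4 Prop. 6.11 (6.4.1)] [cite: Hartshorne1977, App. C Ex. 5.2] -/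
theorem tateConjectureFor_tensor_projectiveSpace_iff (hE : E.HasLefschetzTraceFormula)
    (hχ : ((χ (arithFrob k) : Kˣ) : K) = Nat.card k)
    (hRH : E.WeilRiemannHypothesisFor (projectiveSpace r k) r) (hX : IsSmoothProjective n X) (c : ℕ) :
    E.TateConjectureFor (X ⊗ projectiveSpace r k) c ↔
      ∀ p q : ℕ, p + q = c → q ≤ r → E.TateConjectureFor X p := by
  have hP := isSmoothProjective_projectiveSpace_holds k r
  rw [E.tateConjectureFor_tensor_iff hX hP (E.algebraicClasses_projectiveSpace_eq_top hE hχ hRH)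
    (fun _ hj ↦ E.finrank_projectiveSpace_of_odd hE hχ hRH hj) c]
  refine forall_congr' fun p ↦ forall_congr' fun q ↦ forall_congr' fun _ ↦ ?_
  rw [E.nontrivial_projectiveSpace_iff hE hχ hRH]

/-- **`Tᵖ(X)` for `c − r ≤ p ≤ c` ⟹ `Tᶜ(X × 𝐏ʳ)`** over a finite field. [cite: Milne2007TateFiniteFieldsAIM, Cor. 2.2]
[cite: Tate1994, §1 (Conjecture Tᵖ)] -/
theorem tateConjectureFor_tensor_projectiveSpace_of_forall (hE : E.HasLefschetzTraceFormula)
    (hχ : ((χ (arithFrob k) : Kˣ) : K) = Nat.card k)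
    (hRH : E.WeilRiemannHypothesisFor (projectiveSpace r k) r) (hX : IsSmoothProjective n X) {c : ℕ}
    (hT : ∀ p q : ℕ, p + q = c → q ≤ r → E.TateConjectureFor X p) :
    E.TateConjectureFor (X ⊗ projectiveSpace r k) c :=
  (E.tateConjectureFor_tensor_projectiveSpace_iff hE hχ hRH hX c).mpr hT

/-- **`T(X)` in all codimensions ⟹ `T(X × 𝐏ʳ)` in all codimensions** over a finite field («Weil has
computed the zeta function …; it is the determination of the rank of `𝔄ⁱ(V)` which is difficult» — here the
ranks of `X × 𝐏ʳ` are those of `X`). [cite: TateWoodsHole1965, §3 (12)–(13)]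
[cite: Milne2007TateFiniteFieldsAIM, Cor. 2.2] [cite: Tate1994, §1 (Conjecture Tᵖ)] -/
theorem tateConjectureFor_tensor_projectiveSpace (hE : E.HasLefschetzTraceFormula)
    (hχ : ((χ (arithFrob k) : Kˣ) : K) = Nat.card k)
    (hRH : E.WeilRiemannHypothesisFor (projectiveSpace r k) r) (hX : IsSmoothProjective n X)
    (hT : ∀ p, E.TateConjectureFor X p) (c : ℕ) : E.TateConjectureFor (X ⊗ projectiveSpace r k) c :=
  E.tateConjectureFor_tensor_projectiveSpace_of_forall hE hχ hRH hX fun p _ _ _ ↦ hT p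

/-- **`Tᶜ(X × 𝐏ʳ) ⟹ Tᵖ(X)` for `c − r ≤ p ≤ c`** over a finite field (for `p = c` the tree's
`tateConjectureFor_of_tensor_left`). [cite: Milne2007TateFiniteFieldsAIM, Cor. 2.2] [cite: Tate1994, §1 (Conjecture Tᵖ)]
[cite: Kleiman1968AlgebraicCycles, §1.2 Prop. 1.2.4] -/
theorem tateConjectureFor_of_tensor_projectiveSpace (hE : E.HasLefschetzTraceFormula)
    (hχ : ((χ (arithFrob k) : Kˣ) : K) = Nat.card k)
    (hRH : E.WeilRiemannHypothesisFor (projectiveSpace r k) r) (hX : IsSmoothProjective n X) {p q c : ℕ}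
    (hpq : p + q = c) (hq : q ≤ r) (hT : E.TateConjectureFor (X ⊗ projectiveSpace r k) c) :
    E.TateConjectureFor X p :=
  (E.tateConjectureFor_tensor_projectiveSpace_iff hE hχ hRH hX c).mp hT p q hpq hq

/-- **`T(𝐏ʳ × X)` from `T(X)`** (braiding). [cite: Milne2007TateFiniteFieldsAIM, Cor. 2.2] [cite: Tate1994, §1 (Conjecture Tᵖ)] -/
theorem tateConjectureFor_projectiveSpace_tensor (hE : E.HasLefschetzTraceFormula)
    (hχ : ((χ (arithFrob k) : Kˣ) : K) = Nat.card k)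
    (hRH : E.WeilRiemannHypothesisFor (projectiveSpace r k) r) (hX : IsSmoothProjective n X)
    (hT : ∀ p, E.TateConjectureFor X p) (c : ℕ) : E.TateConjectureFor (projectiveSpace r k ⊗ X) c :=
  E.tateConjectureFor_tensor_comm hX (isSmoothProjective_projectiveSpace_holds k r)
    (E.tateConjectureFor_tensor_projectiveSpace hE hχ hRH hX hT c)

/-- **`T(𝐏ᵃ × 𝐏ʳ)` in every codimension** over a finite field, granted the Riemann hypothesis for `𝐏ᵃ` and
`𝐏ʳ` in `E` (`T(𝐏ᵃ)` is the tree's `tateConjectureFor_projectiveSpace`). [cite: TateWoodsHole1965, §3 (13)]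
[cite: Tate1994, §1 (Conjecture Tᵖ)] [cite: Hartshorne1977, App. C Ex. 5.2] -/
theorem tateConjectureFor_projectiveSpace_prod (hE : E.HasLefschetzTraceFormula)
    (hχ : ((χ (arithFrob k) : Kˣ) : K) = Nat.card k) {a : ℕ}
    (hRHa : E.WeilRiemannHypothesisFor (projectiveSpace a k) a)
    (hRH : E.WeilRiemannHypothesisFor (projectiveSpace r k) r) (c : ℕ) :
    E.TateConjectureFor (projectiveSpace a k ⊗ projectiveSpace r k) c :=
  E.tateConjectureFor_tensor_projectiveSpace hE hχ hRH (isSmoothProjective_projectiveSpace_holds k a)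
    (E.tateConjectureFor_projectiveSpace hE hχ hRHa) c

/-- **Every even-degree class on `X × 𝐏ʳ` is algebraic when every even-degree class on `X` is** (over a
finite field, RH for `𝐏ʳ` in `E`), e.g. `𝐏ᵃ × 𝐏ʳ`, `G(1, 𝐏ⁿ⁺¹) × 𝐏ʳ`.
[cite: Kahn2020, §6.4 Prop. 6.11 (6.4.1) and Prop. 6.12] [cite: Hartshorne1977, App. C Ex. 5.2] -/
theorem algebraicClasses_tensor_projectiveSpace_eq_top (hE : E.HasLefschetzTraceFormula)
    (hχ : ((χ (arithFrob k) : Kˣ) : K) = Nat.card k)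
    (hRH : E.WeilRiemannHypothesisFor (projectiveSpace r k) r) (hX : IsSmoothProjective n X)
    (hXalg : ∀ p, E.algebraicClasses X p = ⊤) (c : ℕ) :
    E.algebraicClasses (X ⊗ projectiveSpace r k) c = ⊤ :=
  E.algebraicClasses_tensor_eq_top hX (isSmoothProjective_projectiveSpace_holds k r) hXalg
    (E.algebraicClasses_projectiveSpace_eq_top hE hχ hRH)
    (fun _ hj ↦ E.finrank_projectiveSpace_of_odd hE hχ hRH hj) c

end ProjectiveSpace

end GaloisWeilCohomology

end Literature.AlgebraicGeometry.Motives

end
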